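import Summits.HodgeConjecture.CorCM.MultiFieldWeilSeparatedThreefoldPairsAnyCurves
import HarnessLib

/-!
# MULTI-FIELD WEIL ENGINE — THE SURFACE BLOCK UP TO ITS SHARP LIMIT: any simple CM surfaces NO THREE OF WHICH (pairwise non-isogenous) SHARE A GALOIS CLOSURE,
# with any CM elliptic curves — unconditional; hence the gen-35 roofs with «at most two surfaces» replaced by «no dihedral triple»

Cell `pub-hodgecm2` (COR-CM), seat b30 gen 35 (2026-08-25); count-neutral own lane MULTI-FIELD WEIL ENGINE (stem `MultiFieldWeil*`), sequel of
`CorCM/MultiFieldWeilAtMostTwoThreefoldsTwoSurfacesAnyCurves.lean` and `CorCM/MultiFieldWeilSeparatedThreefoldPairsAnyCurves.lean`.  Theorems only; no definition, no named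
fact, no `sorry`.  HONEST FRAMING: §1 is UNCONDITIONAL (seat p2's census of curves and simple surfaces BY NAME); §2–§3 are conditional on the displayed Markman fourfold
binder only; `HC_CM` is NOT proved and not asserted.

THE POINT.  In the gen-35 roofs the surface block was fed by «at most two quartic slots».  Seat p2's census `CMCurvesAndSurfaces.hodgeConjectureFor_prod_curves_simpleSurfaces_of_closures`
is sharper: pairwise non-isogenous CM elliptic curves and simple CM surfaces NO THREE OF WHOSE FIELDS SHARE A GALOIS CLOSURE have all products of copies divisor-generated —
and seat b16's dihedral triple (three of the four isogeny classes of simple CM surfaces inside one `D₄`-closure) shows this is where it stops.  §1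
(**`hodgeConjectureFor_prod_surfaceBlock_of_closures`**) puts the census in this lane's uniform-family form: `A_i ⊨ (K_i; Φ_i)` simple of dimension `≤ 3`, isogenous
duplicates allowed, hypothesis **(iii′) among any three quartic slots whose fields have one and the same Galois closure in `ℂ`, two carry isogenous surfaces**; then every
product of copies of members meeting no sextic slot satisfies the Hodge conjecture, UNCONDITIONALLY (representatives of the isogeny classes; a curve's closure is shared with no
other representative, b16's `CMCurvesAndSurfaces.normalClosure_ne_of_finrank_eq_two`).  §2 (**`hodgeConjectureFor_prod_of_atMostTwo_threefolds_of_closures_of_markman`**): at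
most two sextic slots + (iii′) + any curves ⟹ the Hodge conjecture for every product of copies mod Markman 4.  §3
(**`hodgeConjectureFor_prod_of_separatedThreefoldPairs_of_closures_of_markman`**): pairwise separated groups of at most two threefolds + (iii′) + any curves, mod Markman 4.
(A cyclic quartic CM field carries ONE isogeny class of simple CM surfaces, a `D₄`-closure FOUR; so (iii′) reads: from each dihedral closure at most two of its four classes.)

[cite: MoonenZarhin1999LowDim, Thm. (0.1), Thm. (0.2), §3 (3.1), Cor. (3.9), §5 (5.2)] [cite: Markman2025SurveySecant, Thm. 1.2] [cite: Gordon1999HodgeAVSurvey, §3 Theorem (proof), 7.4–7.7, 9.2, 10.10]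
[cite: Shimura1998, §8.2 Prop. 26, §8.4 (1), (2)] [cite: MumfordAV1970, §19 Thm. 1 and p. 169]

## References
* [MoonenZarhin1999LowDim] B. Moonen, Yu. Zarhin, Math. Ann. 315 (1999) 711–733.  [Markman2025SurveySecant] E. Markman, arXiv:2509.23403, Thm. 1.2.
  [Gordon1999HodgeAVSurvey] B. B. Gordon, *A survey of the Hodge conjecture for abelian varieties*, §3, 7.4–7.7, 9.2, 10.10.  [Shimura1998] G. Shimura, *Abelian varieties
  with complex multiplication and modular functions*, §8.2, §8.4.  [MumfordAV1970] D. Mumford, *Abelian Varieties*, §19.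
-/

noncomputable section

open CategoryTheory CategoryTheory.Limits NumberField IntermediateField

namespace Summit.HodgeConjecture.CorCM.MultiFieldWeil

open Literature.AlgebraicGeometry Literature.AlgebraicGeometry.Motives Literature.AlgebraicGeometry.HodgeTheory
open Literature.AlgebraicGeometry.ComplexMultiplication (IsCMTypeRealisation)
open Literature.AlgebraicTopology.SingularHomology
open Literature.NumberTheory.ComplexMultiplication
open Literature.AlgebraicGeometry.Pohlmann1968

open scoped Classical

section Family

variable {I : Type} [Fintype I] {K : I → Type} [∀ i, Field (K i)] [∀ i, NumberField (K i)] [∀ i, IsCMField (K i)]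
  {Φ : ∀ i, CMType (K i)} {A : I → AbelianVariety ℂ} {ι : ∀ i, 𝓞 (K i) →+* End (A i)} {θ : ∀ i, K i →+* Module.End ℂ (complexBetti (A i).X 1)}
  {C : Type}

omit [Fintype I] [∀ i, IsCMField (K i)] in
/-- The CM field of a realisation of dimension `≤ 3` has degree `2`, `4` or `6`. [cite: Shimura1998, §5.2] -/
private theorem finrank_eq_or_of_dim_le_three₃₅c (hA : ∀ i, IsCMTypeRealisation (Φ i) (A i) (ι i) (θ i)) {i : I} (h3 : (A i).dim ≤ 3) :
    Module.finrank ℚ (K i) = 2 ∨ Module.finrank ℚ (K i) = 4 ∨ Module.finrank ℚ (K i) = 6 := by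
  have h := finrank_eq_two_mul_dim_of_isCMTypeRealisation (hA i)
  have hpos : 0 < Module.finrank ℚ (K i) := Module.finrank_pos
  interval_cases hd : (A i).dim <;> omega

omit [Fintype I] [∀ i, IsCMField (K i)] in
/-- An embedding of number fields `K_i ↪ K_t` makes `[K_i : ℚ]` divide `[K_t : ℚ]`. [cite: Shimura1998, §8.1] -/
private theorem finrank_dvd_of_ringHom₃₅c {i t : I} (g : K i →+* K t) : Module.finrank ℚ (K i) ∣ Module.finrank ℚ (K t) := by
  have h1 : Module.finrank ℚ ↥g.toRatAlgHom.fieldRange = Module.finrank ℚ (K i) :=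
    ((AlgEquiv.ofInjectiveField g.toRatAlgHom).toLinearEquiv.finrank_eq).symm
  rw [← h1, ← IntermediateField.finrank_top' (F := ℚ) (E := K t)]
  exact IntermediateField.finrank_dvd_of_le_right le_top

/-! ## §1 The surface block under (iii′): no three non-isogenous surfaces with one Galois closure — unconditional -/

/-- **THE SURFACE BLOCK UP TO ITS SHARP LIMIT (unconditional).**  `A_i ⊨ (K_i; Φ_i)` (`i ∈ I` finite) SIMPLE complex abelian varieties of CM type of dimension `≤ 3`
(isogenous duplicates allowed); **(iii′)** among any three quartic slots whose fields have the same Galois closure in `ℂ`, two carry isogenous surfaces.  Then every product of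
copies `⨁_l A_{ρ l}` meeting no sextic slot — simple CM surfaces and CM elliptic curves only — satisfies the Hodge conjecture: one representative per isogeny class of the
non-sextic slots; the representatives are pairwise non-isogenous curves and simple surfaces no three of whose fields share a closure (a curve's closure is shared with no other
representative, b16), and seat p2's census `CMCurvesAndSurfaces.hodgeConjectureFor_prod_curves_simpleSurfaces_of_closures` applies.
[cite: MoonenZarhin1999LowDim, §3 (3.1), Cor. (3.9), §5 (5.2)] [cite: Gordon1999HodgeAVSurvey, §3 Theorem (proof), 7.5, 9.2 and 10.10] [cite: Shimura1998, §8.4 (1), (2)] -/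
theorem hodgeConjectureFor_prod_surfaceBlock_of_closures (hA : ∀ i, IsCMTypeRealisation (Φ i) (A i) (ι i) (θ i)) (hS : ∀ i, (A i).IsSimple) (h3 : ∀ i, (A i).dim ≤ 3)
    (hS3 : ∀ i j l : I, Module.finrank ℚ (K i) = 4 → Module.finrank ℚ (K j) = 4 → Module.finrank ℚ (K l) = 4 →
      normalClosure ℚ (K i) ℂ = normalClosure ℚ (K j) ℂ → normalClosure ℚ (K j) ℂ = normalClosure ℚ (K l) ℂ →
      AbelianVariety.IsIsogenous (A i) (A j) ∨ AbelianVariety.IsIsogenous (A i) (A l) ∨ AbelianVariety.IsIsogenous (A j) (A l))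
    {M : ℕ} (ρ : Fin M → I) (hρ : ∀ l, Module.finrank ℚ (K (ρ l)) ≠ 6) : HodgeConjectureFor (⨁ fun l => A (ρ l)).dim (⨁ fun l => A (ρ l)).X := by
  cases M with
  | zero => exact hodgeConjectureFor_of_isDivisorGenerated _ (isDivisorGenerated_of_dim_eq_zero _ (dim_biproduct_fin_zero _))
  | succ M =>
    -- the non-sextic slots
    let I' : Type := {i : I // Module.finrank ℚ (K i) ≠ 6}
    haveI : Nonempty I' := ⟨⟨ρ 0, hρ 0⟩⟩
    have hdim : ∀ c : I', Module.finrank ℚ (K c.1) = 2 ∨ Module.finrank ℚ (K c.1) = 4 := fun c => by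
      rcases finrank_eq_or_of_dim_le_three₃₅c hA (h3 c.1) with h | h | h
      · exact Or.inl h
      · exact Or.inr h
      · exact absurd h c.2
    -- representatives of the isogeny classes of the non-sextic slots
    letI : LinearOrder I' := LinearOrder.lift' (Fintype.equivFin I') (Fintype.equivFin I').injective
    let cl : I' → Finset I' := fun a => Finset.univ.filter fun c => AbelianVariety.IsIsogenous (A a.1) (A c.1)
    have hcl : ∀ a c, c ∈ cl a ↔ AbelianVariety.IsIsogenous (A a.1) (A c.1) := fun a c => by
      simp only [cl, Finset.mem_filter, Finset.mem_univ, true_and]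
    have hne : ∀ a, (cl a).Nonempty := fun a => ⟨a, (hcl a a).2 (AbelianVariety.IsIsogenous.refl _)⟩
    let r : I' → I' := fun a => (cl a).min' (hne a)
    have hr_iso : ∀ a, AbelianVariety.IsIsogenous (A a.1) (A (r a).1) := fun a => (hcl a (r a)).1 (Finset.min'_mem _ (hne a))
    have hr_le : ∀ a c, AbelianVariety.IsIsogenous (A a.1) (A c.1) → r a ≤ r c := fun a c h =>
      Finset.min'_le (cl a) (r c) ((hcl a (r c)).2 (h.trans (hr_iso c)))
    have hr_eq : ∀ a c, AbelianVariety.IsIsogenous (A a.1) (A c.1) → r a = r c := fun a c h => le_antisymm (hr_le a c h) (hr_le c a h.symm')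
    have hr_idem : ∀ a, r (r a) = r a := fun a => (hr_eq a (r a) (hr_iso a)).symm
    let J : Type := {c : I' // r c = c}
    haveI : Nonempty J := ⟨⟨r ⟨ρ 0, hρ 0⟩, hr_idem _⟩⟩
    have hniJ : ∀ j j' : J, j ≠ j' → ¬ AbelianVariety.IsIsogenous (A j.1.1) (A j'.1.1) := fun j j' hne' h =>
      hne' (Subtype.ext (by rw [← j.2, ← j'.2]; exact hr_eq _ _ h))
    let ρJ : Fin (M + 1) → J := fun l => ⟨r ⟨ρ l, hρ l⟩, hr_idem _⟩
    have hiso : AbelianVariety.IsIsogenous (⨁ fun l => A (ρ l)) (⨁ fun l => A (ρJ l).1.1) :=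
      AbelianVariety.IsIsogenous.biproduct fun l => hr_iso ⟨ρ l, hρ l⟩
    -- among the representatives no three CM fields share a Galois closure
    have hsep := CMAlgebra.isSeparatingFamily_of_isSimple_of_pairwise_not_isIsogenous (Φ := fun j : J => Φ j.1.1) (A := fun j : J => A j.1.1)
      (ι := fun j : J => ι j.1.1) (θ := fun j : J => θ j.1.1) (fun j => hA j.1.1) (fun j => hS j.1.1) hniJ
    have h3J : ∀ i j k : J, i ≠ j → j ≠ k → i ≠ k → normalClosure ℚ (K i.1.1) ℂ = normalClosure ℚ (K j.1.1) ℂ →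
        normalClosure ℚ (K j.1.1) ℂ ≠ normalClosure ℚ (K k.1.1) ℂ := by
      intro i j k hij hjk hik hLij hLjk
      have hdimJ : ∀ j : J, Module.finrank ℚ (K j.1.1) = 2 ∨ Module.finrank ℚ (K j.1.1) = 4 := fun j => hdim j.1
      have hi4 : Module.finrank ℚ (K i.1.1) = 4 := by
        rcases hdim i.1 with h | h
        · exact absurd hLij (CMCurvesAndSurfaces.normalClosure_ne_of_finrank_eq_two (K := fun j : J => K j.1.1) hdimJ hsep hij h)
        · exact h
      have hj4 : Module.finrank ℚ (K j.1.1) = 4 := by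
        rcases hdim j.1 with h | h
        · exact absurd hLjk (CMCurvesAndSurfaces.normalClosure_ne_of_finrank_eq_two (K := fun j : J => K j.1.1) hdimJ hsep hjk h)
        · exact h
      have hk4 : Module.finrank ℚ (K k.1.1) = 4 := by
        rcases hdim k.1 with h | h
        · exact absurd hLjk.symm (CMCurvesAndSurfaces.normalClosure_ne_of_finrank_eq_two (K := fun j : J => K j.1.1) hdimJ hsep hjk.symm h)
        · exact h
      rcases hS3 i.1.1 j.1.1 k.1.1 hi4 hj4 hk4 hLij hLjk with h | h | h
      · exact hniJ i j hij h
      · exact hniJ i k hik h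
      · exact hniJ j k hjk h
    exact Domination.hodgeConjectureFor_of_avDominatedBy
      ((CMCurvesAndSurfaces.hodgeConjectureFor_prod_curves_simpleSurfaces_of_closures (K := fun j : J => K j.1.1) (A := fun j : J => A j.1.1)
        (Φ := fun j : J => Φ j.1.1) (ι := fun j : J => ι j.1.1) (θ := fun j : J => θ j.1.1) (fun j => hdim j.1) (fun j => hA j.1.1) (fun j => hS j.1.1) hniJ
        h3J ρJ).1)
      (Domination.AVDominatedBy.of_isIsogenous hiso (Domination.AVDominatedBy.refl _))

/-! ## §2 At most two threefolds, surfaces under (iii′), any curves -/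

/-- **AT MOST TWO THREEFOLD SLOTS, SURFACES UP TO THE DIHEDRAL-TRIPLE LIMIT, ANY CURVES, given ONLY Markman's fourfold theorem.**  `A_i ⊨ (K_i; Φ_i)` (`i ∈ I` finite) SIMPLE
of dimension `≤ 3`; among any three sextic slots two coincide; (iii′) among any three quartic slots with one Galois closure two carry isogenous surfaces; any quadratic slots.
Then the Hodge conjecture holds for every product of copies `⨁_j A_{π j}` (the threefold block splits off; blocks by gen 35's threefold-block theorem and §1).
[cite: MoonenZarhin1999LowDim, Thm. (0.1), Thm. (0.2), §3 (3.1), Cor. (3.9)] [cite: Markman2025SurveySecant, Thm. 1.2] [cite: Gordon1999HodgeAVSurvey, §3 Theorem (proof), 7.5–7.7, 10.10] -/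
theorem hodgeConjectureFor_prod_of_atMostTwo_threefolds_of_closures_of_markman (hW4 : Markman2025_weilClasses_algebraic_abelianFourfold)
    (hA : ∀ i, IsCMTypeRealisation (Φ i) (A i) (ι i) (θ i)) (hS : ∀ i, (A i).IsSimple) (h3 : ∀ i, (A i).dim ≤ 3)
    (hT2 : ∀ i j l : I, Module.finrank ℚ (K i) = 6 → Module.finrank ℚ (K j) = 6 → Module.finrank ℚ (K l) = 6 → i = j ∨ i = l ∨ j = l)
    (hS3 : ∀ i j l : I, Module.finrank ℚ (K i) = 4 → Module.finrank ℚ (K j) = 4 → Module.finrank ℚ (K l) = 4 →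
      normalClosure ℚ (K i) ℂ = normalClosure ℚ (K j) ℂ → normalClosure ℚ (K j) ℂ = normalClosure ℚ (K l) ℂ →
      AbelianVariety.IsIsogenous (A i) (A j) ∨ AbelianVariety.IsIsogenous (A i) (A l) ∨ AbelianVariety.IsIsogenous (A j) (A l))
    {N : ℕ} (π : Fin N → I) : HodgeConjectureFor (⨁ fun j => A (π j)).dim (⨁ fun j => A (π j)).X := by
  have hp4 : ∀ i, (∃ t, Module.finrank ℚ (K t) = 6 ∧ Nonempty (K i →+* K t)) → Module.finrank ℚ (K i) ≠ 4 := by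
    rintro i ⟨t, ht, ⟨g⟩⟩ h4
    have h := finrank_dvd_of_ringHom₃₅c g
    rw [h4, ht] at h
    omega
  have hp6 : ∀ i, (¬ ∃ t, Module.finrank ℚ (K t) = 6 ∧ Nonempty (K i →+* K t)) → Module.finrank ℚ (K i) ≠ 6 := fun i hi h6 => hi ⟨i, h6, ⟨RingHom.id _⟩⟩
  by_cases hboth : (∃ i, ∃ t, Module.finrank ℚ (K t) = 6 ∧ Nonempty (K i →+* K t)) ∧ ∃ j, ¬ ∃ t, Module.finrank ℚ (K t) = 6 ∧ Nonempty (K j →+* K t)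
  · exact hodgeConjectureFor_prod_of_threefoldBlock_surfaceBlock hA hS h3 (fun i => ∃ t, Module.finrank ℚ (K t) = 6 ∧ Nonempty (K i →+* K t)) (fun _ => Iff.rfl)
      hboth.1 hboth.2 (fun M ρ hρ => hodgeConjectureFor_prod_threefoldBlock_of_atMostTwo_of_markman hW4 hA hS h3 hT2 ρ fun l => hp4 _ (hρ l))
      (fun M ρ hρ => hodgeConjectureFor_prod_surfaceBlock_of_closures hA hS h3 hS3 ρ fun l => hp6 _ (hρ l)) π
  · rw [not_and_or, not_exists, not_exists] at hboth
    rcases hboth with hnone | hall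
    · exact hodgeConjectureFor_prod_surfaceBlock_of_closures hA hS h3 hS3 π fun l => hp6 _ (hnone (π l))
    · exact hodgeConjectureFor_prod_threefoldBlock_of_atMostTwo_of_markman hW4 hA hS h3 hT2 π fun l => hp4 _ (not_not.1 (hall (π l)))

/-- **Dominated form** of §2. [cite: MoonenZarhin1999LowDim, Thm. (0.1), (0.2)] [cite: Markman2025SurveySecant, Thm. 1.2] [cite: MumfordAV1970, §19 Thm. 1 and p. 169] -/
theorem hodgeConjectureFor_of_avDominatedBy_prod_of_atMostTwo_threefolds_of_closures_of_markman (hW4 : Markman2025_weilClasses_algebraic_abelianFourfold)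
    (hA : ∀ i, IsCMTypeRealisation (Φ i) (A i) (ι i) (θ i)) (hS : ∀ i, (A i).IsSimple) (h3 : ∀ i, (A i).dim ≤ 3)
    (hT2 : ∀ i j l : I, Module.finrank ℚ (K i) = 6 → Module.finrank ℚ (K j) = 6 → Module.finrank ℚ (K l) = 6 → i = j ∨ i = l ∨ j = l)
    (hS3 : ∀ i j l : I, Module.finrank ℚ (K i) = 4 → Module.finrank ℚ (K j) = 4 → Module.finrank ℚ (K l) = 4 →
      normalClosure ℚ (K i) ℂ = normalClosure ℚ (K j) ℂ → normalClosure ℚ (K j) ℂ = normalClosure ℚ (K l) ℂ →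
      AbelianVariety.IsIsogenous (A i) (A j) ∨ AbelianVariety.IsIsogenous (A i) (A l) ∨ AbelianVariety.IsIsogenous (A j) (A l))
    {N : ℕ} (π : Fin N → I) {X : AbelianVariety ℂ} (hX : Domination.AVDominatedBy X (⨁ fun j => A (π j))) : HodgeConjectureFor X.dim X.X :=
  Domination.hodgeConjectureFor_of_avDominatedBy (hodgeConjectureFor_prod_of_atMostTwo_threefolds_of_closures_of_markman hW4 hA hS h3 hT2 hS3 π) hX

/-! ## §3 Separated groups of at most two threefolds, surfaces under (iii′), any curves -/

/-- **SEPARATED GROUPS OF AT MOST TWO THREEFOLDS, SURFACES UP TO THE DIHEDRAL-TRIPLE LIMIT, ANY CURVES, given ONLY Markman's fourfold theorem.**  As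
`hodgeConjectureFor_prod_of_separatedThreefoldPairs_of_markman` with «at most two quartic slots» weakened to (iii′).  `HC_CM` is NOT asserted.
[cite: MoonenZarhin1999LowDim, Thm. (0.1), Thm. (0.2), §3 (3.1), Cor. (3.9)] [cite: Markman2025SurveySecant, Thm. 1.2] [cite: Gordon1999HodgeAVSurvey, §3 Theorem (proof), 7.5–7.7, 10.10] -/
theorem hodgeConjectureFor_prod_of_separatedThreefoldPairs_of_closures_of_markman (hW4 : Markman2025_weilClasses_algebraic_abelianFourfold)
    (hA : ∀ i, IsCMTypeRealisation (Φ i) (A i) (ι i) (θ i)) (hS : ∀ i, (A i).IsSimple) (h3 : ∀ i, (A i).dim ≤ 3) (b : I → C)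
    (hsep : ∀ t t', Module.finrank ℚ (K t) = 6 → Module.finrank ℚ (K t') = 6 → b t ≠ b t' →
      normalClosure ℚ (K t) ℂ ≠ normalClosure ℚ (K t') ℂ ∧ ¬ ∃ F : IntermediateField ℚ (K t), Module.finrank ℚ F = 2 ∧ IsTotallyComplex F ∧ Nonempty (F →+* K t'))
    (hT2 : ∀ t t' t'' : I, Module.finrank ℚ (K t) = 6 → Module.finrank ℚ (K t') = 6 → Module.finrank ℚ (K t'') = 6 → b t = b t' → b t = b t'' →
      t = t' ∨ t = t'' ∨ t' = t'')
    (hS3 : ∀ i j l : I, Module.finrank ℚ (K i) = 4 → Module.finrank ℚ (K j) = 4 → Module.finrank ℚ (K l) = 4 →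
      normalClosure ℚ (K i) ℂ = normalClosure ℚ (K j) ℂ → normalClosure ℚ (K j) ℂ = normalClosure ℚ (K l) ℂ →
      AbelianVariety.IsIsogenous (A i) (A j) ∨ AbelianVariety.IsIsogenous (A i) (A l) ∨ AbelianVariety.IsIsogenous (A j) (A l))
    {N : ℕ} (π : Fin N → I) : HodgeConjectureFor (⨁ fun j => A (π j)).dim (⨁ fun j => A (π j)).X := by
  refine hodgeConjectureFor_prod_of_separatedLabels hA hS h3 b hsep (fun c M ρ hρ => ?_) (fun M ρ hρ => ?_) π
  · -- the block of the label `c`: curves, and at most two threefolds `t₀, t₁` of label `c`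
    cases M with
    | zero => exact hodgeConjectureFor_of_isDivisorGenerated _ (isDivisorGenerated_of_dim_eq_zero _ (dim_biproduct_fin_zero _))
    | succ M =>
      obtain ⟨t₀, ht₀, -, hb₀⟩ := hρ 0
      obtain ⟨t₁, ht₁, hcov⟩ : ∃ t₁, Module.finrank ℚ (K t₁) = 6 ∧ ∀ t, Module.finrank ℚ (K t) = 6 → b t = c → t = t₀ ∨ t = t₁ := by
        by_cases hT' : ∃ t, Module.finrank ℚ (K t) = 6 ∧ b t = c ∧ t ≠ t₀
        · obtain ⟨t₁, ht₁, hb₁, hne⟩ := hT'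
          refine ⟨t₁, ht₁, fun t ht hbt => ?_⟩
          rcases hT2 t₀ t₁ t ht₀ ht₁ ht (hb₀.trans hb₁.symm) (hb₀.trans hbt.symm) with h | h | h
          · exact absurd h.symm hne
          · exact Or.inl h.symm
          · exact Or.inr h.symm
        · exact ⟨t₀, ht₀, fun t ht hbt => Or.inl (by by_contra h; exact hT' ⟨t, ht, hbt, h⟩)⟩
      refine hodgeConjectureFor_prod_threefoldBlock_of_markman hW4 hA hS ht₀ ht₁ ρ fun l => ?_
      obtain ⟨t, ht, ⟨e⟩, hbt⟩ := hρ l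
      rcases finrank_eq_or_of_dim_le_three₃₅c hA (h3 (ρ l)) with h2 | h4 | h6
      · exact Or.inl h2
      · exfalso
        have h := finrank_dvd_of_ringHom₃₅c e
        rw [h4, ht] at h
        omega
      · exact Or.inr (hcov (ρ l) h6 ((label_eq_of_ringHom_ringHom hA h3 b hsep h6 ht (RingHom.id _) e).trans hbt))
  · exact hodgeConjectureFor_prod_surfaceBlock_of_closures hA hS h3 hS3 ρ fun l h6 => hρ l ⟨ρ l, h6, ⟨RingHom.id _⟩⟩

/-- **Dominated form** of §3. [cite: MoonenZarhin1999LowDim, Thm. (0.1), (0.2)] [cite: Markman2025SurveySecant, Thm. 1.2] [cite: MumfordAV1970, §19 Thm. 1 and p. 169] -/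
theorem hodgeConjectureFor_of_avDominatedBy_prod_of_separatedThreefoldPairs_of_closures_of_markman (hW4 : Markman2025_weilClasses_algebraic_abelianFourfold)
    (hA : ∀ i, IsCMTypeRealisation (Φ i) (A i) (ι i) (θ i)) (hS : ∀ i, (A i).IsSimple) (h3 : ∀ i, (A i).dim ≤ 3) (b : I → C)
    (hsep : ∀ t t', Module.finrank ℚ (K t) = 6 → Module.finrank ℚ (K t') = 6 → b t ≠ b t' →
      normalClosure ℚ (K t) ℂ ≠ normalClosure ℚ (K t') ℂ ∧ ¬ ∃ F : IntermediateField ℚ (K t), Module.finrank ℚ F = 2 ∧ IsTotallyComplex F ∧ Nonempty (F →+* K t'))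
    (hT2 : ∀ t t' t'' : I, Module.finrank ℚ (K t) = 6 → Module.finrank ℚ (K t') = 6 → Module.finrank ℚ (K t'') = 6 → b t = b t' → b t = b t'' →
      t = t' ∨ t = t'' ∨ t' = t'')
    (hS3 : ∀ i j l : I, Module.finrank ℚ (K i) = 4 → Module.finrank ℚ (K j) = 4 → Module.finrank ℚ (K l) = 4 →
      normalClosure ℚ (K i) ℂ = normalClosure ℚ (K j) ℂ → normalClosure ℚ (K j) ℂ = normalClosure ℚ (K l) ℂ →
      AbelianVariety.IsIsogenous (A i) (A j) ∨ AbelianVariety.IsIsogenous (A i) (A l) ∨ AbelianVariety.IsIsogenous (A j) (A l))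
    {N : ℕ} (π : Fin N → I) {X : AbelianVariety ℂ} (hX : Domination.AVDominatedBy X (⨁ fun j => A (π j))) : HodgeConjectureFor X.dim X.X :=
  Domination.hodgeConjectureFor_of_avDominatedBy (hodgeConjectureFor_prod_of_separatedThreefoldPairs_of_closures_of_markman hW4 hA hS h3 b hsep hT2 hS3 π) hX

end Family

end Summit.HodgeConjecture.CorCM.MultiFieldWeil

end
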